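import Mathlib
import HarnessLib
import Summits.AtomisticToContinuum.Crystallization.Theses.SquareWellLayerCake

/-!
# Route SquareWellLayerCake — Assembly

The assembly item `Assembly` of route `route-AtomisticToContinuum-SquareWellLayerCake` is, verbatim,
the type of the route's deciding theorem `closes`
(`AveragedTwelve → TwelveWithinOne → GapTwelveToBarlow → StackingFaultSparsity → Crystallization`),
so it is discharged by that theorem.
-/

namespace Summit.AtomisticToContinuum.Crystallization.Theorems

open Summit.AtomisticToContinuum.Crystallization.Theses.SquareWellLayerCake

/-- The assembly of route SquareWellLayerCake: the four cruxes `AveragedTwelve`, `TwelveWithinOne`,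
`GapTwelveToBarlow` and `StackingFaultSparsity` together imply `Crystallization`; this is exactly the
route's deciding theorem `closes`. Closes item stmt-AtomisticToContinuum-15810. -/
theorem squareWellLayerCake_assembly_proof :
    Summit.AtomisticToContinuum.Crystallization.Theses.SquareWellLayerCake.Assembly := by
  unfold Summit.AtomisticToContinuum.Crystallization.Theses.SquareWellLayerCake.Assembly
  intro hK1 hK2 hK3 hS
  exact closes hK1 hK2 hK3 hS

end Summit.AtomisticToContinuum.Crystallization.Theorems
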